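import Summits.QuantumFields.BalabanUV.Beta.EriceFlowEnclosureB12AsPrintedHistoryContagionShiftFlowZeroIsometry

/-!
# Beta / EriceFlowEnclosureB12AsPrintedHistoryContagionShiftFlowZeroSemigroup — ASYMPTOTIC FREEDOM IS CONTAGIOUS, part 46: THE CONTINUOUS RENORMALIZATION GROUP OF THE FLOW
# WITH MEMORY.  Erice's renormalization group is DISCRETE (one step = one block-spin ∕ averaging operation, scale factor L), and with memory it is not even a map of the
# coupling.  Near the zero pin parts 34–35 conjugated it to a translation: the Λ-coordinate Λ, strictly decreasing and continuous on ]0, e′], onto a half-line, with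
# `Λ(h k) = Λ e + kβ₀` along every trajectory.  Here (§71, ABSTRACT: any strictly antitone Λ on ]0, e′] onto `[Λ e′, ∞[`): the maps
# **`φ_s g = Λ⁻¹(Λ g + sβ₀)`** (`Function.invFunOn Λ (Ioc 0 e′)`, NO new definition), `s ≥ 0`, form a ONE-PARAMETER SEMIGROUP of ]0, e′] — `φ_0 = id`,
# `φ_{s+s′} = φ_s ∘ φ_{s′}` (`rg_add`), each `φ_s` strictly increasing, `s ↦ φ_s g` strictly decreasing to 0 — whose INTEGER TIMES ARE THE TRAJECTORIES:
# `φ_k e = h k` for every sequence with the Abel relation (`rg_natCast_eq`); so `φ_1` IS the renormalization step and `φ_{1∕2}` an ITERATIVE SQUARE ROOT of it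
# (`rg_half_half`: HALF A RENORMALIZATION STEP).  §72, FOR THE FLOW (from ONE AF reference and part 14's package at e′, via part 35's Λ): THE CONTINUOUS
# RENORMALIZATION GROUP EXISTS near zero pin (**`continuousRG_exists`**): a semigroup `φ` on ]0, e′] as above whose integer-time orbits are EXACTLY the box solutions of
# the flow with memory (`φ_k e = h k` for every box solution h from every pin e), whose continuous running coupling `s ↦ φ_s g` climbs the chart at a rate between
# `(3∕4)β₀` and `(3∕2)β₀` per unit scale (`(3∕4)β₀(s′ − s) ≤ 1∕φ_{s′}(g)² − 1∕φ_s(g)² ≤ (3∕2)β₀(s′ − s)`) and obeys THE CONTINUOUS CLOCK **`s·β₀·φ_s(g)² → 1`**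
# (part 44's asymptotic scaling) — the interpolation of the universal discrete clock `m·g_m² → 1∕β₀` of part 33 to all real scales.  CANONICITY: the construction
# depends on Λ only up to its additive constant, so (part 44 `dynAbel_sub_dynAbel`, part 45 `abel_levy_eq_dynAbel`) EVERY dynamical or Lévy-isometric Abel function
# generates THE SAME semigroup (part 47 `…ZeroSemigroupCanonical`), while a non-principal Abel function generates a DIFFERENT half-step (part 48's witness).
# Abstract in B (β-flow team, prover 1, unit `b2b-balaban-beta-bflow-p1`, gen 40; ROW AP-I·Uc × NODE U2 × ROW Λ — embedding the discrete RG in a flow)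

HONEST FRAMING (page 1 of everything the β sub-cell writes): discharging `BetaPertH` makes Bałaban's UV stability UNCONDITIONAL — a
real constructive-QFT result; it is NOT the continuum limit and NOT the Clay problem.  HONEST DEPENDENCY (cell reorg 2026-08-19,
verbatim): «continuum YM on T⁴ ⇐ BetaPertH ∧ nine spine estimates (0/9 proved); BetaPertH ⇐ (D1) ∧ (D4) ∧ CAP+tail; G-an2-4 gates
asym, D1 and NE2/3/4.»  THIS MODULE DISCHARGES NOTHING: elementary order theory and real analysis (inverse of a strictly monotone function via Mathlib's `Function.invFunOn`,
injectivity, an ε∕S₀ argument, one composition of limits) over node U2's HYPOTHESIS SHAPES `T4BetaStationary.{SeqBox, MemoryProfile}`, `T4BetaFlowWellPosed.{MemFlow,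
solution}` on an ABSTRACT functional `B`; part 35's `relativeLambda_exists`, part 44's `tendsto_sq_mul_dynAbel` BY NAME — nothing restated.  PRECEDENTS (classical, cited
not imported): the embedding of a map in a flow through an Abel function («iteration group», fractional iterates) — G. Szekeres, Acta Math. 100 (1958) 203–258; M. C. Zdun,
ESAIM Proc. 46 (2014) §1; in the tree, gen 14's #38 `EriceFlowEnclosureAbelCoordinate` (Markov ∕ Erice picture: Λ conjugates the step to a translation; no embedding built).
`ScaleShiftRate` (GAPS G-t4-U2-1), `HistLipschitz`∕`FadingMemory` (G-t4-U2-2), [I] THEOREM 2 (p. 259, STATED WITHOUT PROOF) do not occur in this abstract part (carrier END: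
part 50); NOTHING is asserted about Bałaban's actual β — in particular NOT that Bałaban's block-spin RG is the time-one map of a flow of EFFECTIVE ACTIONS: the
semigroup acts on COUPLINGS near the zero pin only.  [I] = T. Bałaban, Commun. Math. Phys. **109** (1987) 249–301 [Balaban1987RG1].

WHAT THIS FILE PROVES (0 sorry, 0 def): §71 `le_add_of_mem`, **`rg_mem_eq`**, `rg_zero`, **`rg_add`**, **`rg_natCast_eq`**, `rg_half_half`, `rg_lt_rg_of_lt`,
`rg_strictMonoOn`, `rg_le_self`, **`rg_tendsto_zero`**; §72 **`continuousRG_exists`**.  NOT CLAIMED: uniqueness of the embedding among ALL continuous embeddings (false: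
part 48); a flow on effective actions; anything about Bałaban's β; `BetaPertH`; continuum; Clay.
-/

namespace Summit.QuantumFields.BalabanUV.Beta.EriceFlowEnclosureB12AsPrintedHistoryContagionShiftFlowZeroSemigroup

open Filter Topology Set Function
open Literature.MathematicalPhysics.QuantumFieldTheory.Balaban1983to89
open Literature.MathematicalPhysics.QuantumFieldTheory.Balaban1983to89.T4BetaStationary (SeqBox MemoryProfile)
open Literature.MathematicalPhysics.QuantumFieldTheory.Balaban1983to89.T4BetaFlowWellPosed (MemFlow solution)
open Summit.QuantumFields.BalabanUV.Beta.EriceFlowEnclosureB12AsPrintedHistoryContagionShiftFlowZeroLambda (relativeLambda_exists)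
open Summit.QuantumFields.BalabanUV.Beta.EriceFlowEnclosureB12AsPrintedHistoryContagionShiftFlowZeroIsometry (tendsto_sq_mul_dynAbel)

noncomputable section

/-! ## §71 The semigroup generated by an Abel function: `φ_s = Λ⁻¹ ∘ (Λ + sβ₀)` on ]0, e′] -/

variable {Λ : ℝ → ℝ} {e' β₀ : ℝ}

/-- Values above the reference value are attained: for `g ∈ ]0, e′]` and `s ≥ 0` (β₀ ≥ 0), `Λ e′ ≤ Λ g + sβ₀`. [folklore] -/
theorem le_add_of_mem (hanti : StrictAntiOn Λ (Ioc 0 e')) (hβ₀ : 0 ≤ β₀) {g s : ℝ} (hg : g ∈ Ioc (0 : ℝ) e') (hs : 0 ≤ s) :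
    Λ e' ≤ Λ g + s * β₀ := by
  have he' : e' ∈ Ioc (0 : ℝ) e' := ⟨hg.1.trans_le hg.2, le_rfl⟩
  have h1 : Λ e' ≤ Λ g := hanti.antitoneOn hg he' hg.2
  nlinarith

/-- **THE TIME-s MAP IS WELL DEFINED**: for Λ strictly antitone on ]0, e′] and onto `[Λ e′, ∞[`, `g ∈ ]0, e′]`, `s ≥ 0`: `φ_s g := invFunOn Λ (Ioc 0 e′) (Λ g + sβ₀)` lies in
]0, e′] and **`Λ(φ_s g) = Λ g + sβ₀`** — in the coordinate Λ the time-s map is the translation by `sβ₀`. [folklore; Szekeres 1958] -/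
theorem rg_mem_eq (hanti : StrictAntiOn Λ (Ioc 0 e')) (honto : ∀ y : ℝ, Λ e' ≤ y → ∃ x ∈ Ioc (0 : ℝ) e', Λ x = y) (hβ₀ : 0 ≤ β₀)
    {g s : ℝ} (hg : g ∈ Ioc (0 : ℝ) e') (hs : 0 ≤ s) :
    invFunOn Λ (Ioc 0 e') (Λ g + s * β₀) ∈ Ioc (0 : ℝ) e' ∧ Λ (invFunOn Λ (Ioc 0 e') (Λ g + s * β₀)) = Λ g + s * β₀ := by
  have hex : ∃ x ∈ Ioc (0 : ℝ) e', Λ x = Λ g + s * β₀ := honto _ (le_add_of_mem hanti hβ₀ hg hs)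
  exact ⟨invFunOn_mem hex, invFunOn_eq hex⟩

/-- `φ_0 = id` on ]0, e′]. [folklore] -/
theorem rg_zero (hanti : StrictAntiOn Λ (Ioc 0 e')) {g : ℝ} (hg : g ∈ Ioc (0 : ℝ) e') : invFunOn Λ (Ioc 0 e') (Λ g + 0 * β₀) = g := by
  rw [zero_mul, add_zero]
  exact hanti.injOn.leftInvOn_invFunOn hg

/-- **THE SEMIGROUP LAW `φ_{s+s′} = φ_s ∘ φ_{s′}`** (s, s′ ≥ 0): both sides lie in ]0, e′] and have the Λ-value `Λ g + (s + s′)β₀`. [folklore; Szekeres 1958] -/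
theorem rg_add (hanti : StrictAntiOn Λ (Ioc 0 e')) (honto : ∀ y : ℝ, Λ e' ≤ y → ∃ x ∈ Ioc (0 : ℝ) e', Λ x = y) (hβ₀ : 0 ≤ β₀)
    {g s s' : ℝ} (hg : g ∈ Ioc (0 : ℝ) e') (hs : 0 ≤ s) (hs' : 0 ≤ s') :
    invFunOn Λ (Ioc 0 e') (Λ g + (s + s') * β₀) = invFunOn Λ (Ioc 0 e') (Λ (invFunOn Λ (Ioc 0 e') (Λ g + s' * β₀)) + s * β₀) := by
  obtain ⟨m₁, e₁⟩ := rg_mem_eq hanti honto hβ₀ hg (add_nonneg hs hs')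
  obtain ⟨m₂, e₂⟩ := rg_mem_eq hanti honto hβ₀ hg hs'
  obtain ⟨m₃, e₃⟩ := rg_mem_eq hanti honto hβ₀ m₂ hs
  refine (hanti.eq_iff_eq m₁ m₃).mp ?_ |>.symm
  rw [e₁, e₃, e₂]; ring

/-- **THE INTEGER TIMES ARE THE TRAJECTORIES**: if a sequence h in ]0, e′] satisfies the Abel relation `Λ(h k) = Λ e + kβ₀` (every box solution from e does, parts 35 ∕ 44),
then **`φ_k e = h k`** for every k — in particular `φ_1` is the renormalization step `e ↦ h 1`. [folklore] -/
theorem rg_natCast_eq (hanti : StrictAntiOn Λ (Ioc 0 e')) (honto : ∀ y : ℝ, Λ e' ≤ y → ∃ x ∈ Ioc (0 : ℝ) e', Λ x = y) (hβ₀ : 0 ≤ β₀)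
    {e : ℝ} {h : ℕ → ℝ} (he : e ∈ Ioc (0 : ℝ) e') (hmem : ∀ k, h k ∈ Ioc (0 : ℝ) e') (habel : ∀ k : ℕ, Λ (h k) = Λ e + (k : ℝ) * β₀) (k : ℕ) :
    invFunOn Λ (Ioc 0 e') (Λ e + (k : ℝ) * β₀) = h k := by
  obtain ⟨m₁, e₁⟩ := rg_mem_eq hanti honto hβ₀ he (Nat.cast_nonneg k)
  exact (hanti.eq_iff_eq m₁ (hmem k)).mp (by rw [e₁, habel]) |>.symm

/-- **HALF A RENORMALIZATION STEP**: `φ_{1∕2} ∘ φ_{1∕2} = φ_1` — the time-½ map is an ITERATIVE SQUARE ROOT of the renormalization step. [folklore; Szekeres 1958] -/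
theorem rg_half_half (hanti : StrictAntiOn Λ (Ioc 0 e')) (honto : ∀ y : ℝ, Λ e' ≤ y → ∃ x ∈ Ioc (0 : ℝ) e', Λ x = y) (hβ₀ : 0 ≤ β₀)
    {g : ℝ} (hg : g ∈ Ioc (0 : ℝ) e') :
    invFunOn Λ (Ioc 0 e') (Λ (invFunOn Λ (Ioc 0 e') (Λ g + 1 / 2 * β₀)) + 1 / 2 * β₀) = invFunOn Λ (Ioc 0 e') (Λ g + 1 * β₀) := by
  rw [show (1 : ℝ) = 1 / 2 + 1 / 2 by norm_num, rg_add hanti honto hβ₀ hg (by norm_num) (by norm_num)]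
  norm_num

/-- `s ↦ φ_s g` is STRICTLY DECREASING (β₀ > 0): later scales, smaller coupling. [folklore] -/
theorem rg_lt_rg_of_lt (hanti : StrictAntiOn Λ (Ioc 0 e')) (honto : ∀ y : ℝ, Λ e' ≤ y → ∃ x ∈ Ioc (0 : ℝ) e', Λ x = y) (hβ₀ : 0 < β₀)
    {g s s' : ℝ} (hg : g ∈ Ioc (0 : ℝ) e') (hs : 0 ≤ s) (hss' : s < s') :
    invFunOn Λ (Ioc 0 e') (Λ g + s' * β₀) < invFunOn Λ (Ioc 0 e') (Λ g + s * β₀) := by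
  obtain ⟨m₁, e₁⟩ := rg_mem_eq hanti honto hβ₀.le hg hs
  obtain ⟨m₂, e₂⟩ := rg_mem_eq hanti honto hβ₀.le hg (hs.trans hss'.le)
  refine (hanti.lt_iff_gt m₁ m₂).mp ?_
  rw [e₁, e₂]; nlinarith

/-- Each `φ_s` (s ≥ 0) is STRICTLY INCREASING on ]0, e′]: the order of couplings is preserved at every real scale. [folklore] -/
theorem rg_strictMonoOn (hanti : StrictAntiOn Λ (Ioc 0 e')) (honto : ∀ y : ℝ, Λ e' ≤ y → ∃ x ∈ Ioc (0 : ℝ) e', Λ x = y) (hβ₀ : 0 ≤ β₀)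
    {s : ℝ} (hs : 0 ≤ s) : StrictMonoOn (fun g => invFunOn Λ (Ioc 0 e') (Λ g + s * β₀)) (Ioc 0 e') := by
  intro g hg g' hg' hgg'
  obtain ⟨m₁, e₁⟩ := rg_mem_eq hanti honto hβ₀ hg hs
  obtain ⟨m₂, e₂⟩ := rg_mem_eq hanti honto hβ₀ hg' hs
  refine (hanti.lt_iff_gt m₂ m₁).mp ?_
  rw [e₁, e₂]
  linarith [(hanti.lt_iff_gt hg' hg).mpr hgg']

/-- `φ_s g ≤ g` (s ≥ 0, β₀ ≥ 0). [folklore] -/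
theorem rg_le_self (hanti : StrictAntiOn Λ (Ioc 0 e')) (honto : ∀ y : ℝ, Λ e' ≤ y → ∃ x ∈ Ioc (0 : ℝ) e', Λ x = y) (hβ₀ : 0 ≤ β₀)
    {g s : ℝ} (hg : g ∈ Ioc (0 : ℝ) e') (hs : 0 ≤ s) : invFunOn Λ (Ioc 0 e') (Λ g + s * β₀) ≤ g := by
  obtain ⟨m₁, e₁⟩ := rg_mem_eq hanti honto hβ₀ hg hs
  refine (hanti.le_iff_ge hg m₁).mp ?_
  rw [e₁]; nlinarith

/-- **`φ_s g → 0` AS `s → ∞`** (β₀ > 0): the continuous running coupling is asymptotically free. [folklore] -/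
theorem rg_tendsto_zero (hanti : StrictAntiOn Λ (Ioc 0 e')) (honto : ∀ y : ℝ, Λ e' ≤ y → ∃ x ∈ Ioc (0 : ℝ) e', Λ x = y) (hβ₀ : 0 < β₀)
    {g : ℝ} (hg : g ∈ Ioc (0 : ℝ) e') : Tendsto (fun s : ℝ => invFunOn Λ (Ioc 0 e') (Λ g + s * β₀)) atTop (𝓝 0) := by
  have he' : 0 < e' := hg.1.trans_le hg.2
  refine Metric.tendsto_atTop.mpr fun ε hε => ?_
  set δ : ℝ := min ε e' with hδ
  have hδmem : δ ∈ Ioc (0 : ℝ) e' := ⟨lt_min hε he', min_le_right _ _⟩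
  refine ⟨max ((Λ δ - Λ g) / β₀ + 1) 0, fun s hs => ?_⟩
  have hs0 : 0 ≤ s := (le_max_right _ _).trans hs
  obtain ⟨m₁, e₁⟩ := rg_mem_eq hanti honto hβ₀.le hg hs0
  have hval : Λ δ < Λ (invFunOn Λ (Ioc 0 e') (Λ g + s * β₀)) := by
    rw [e₁]
    have h1 : (Λ δ - Λ g) / β₀ + 1 ≤ s := (le_max_left _ _).trans hs
    have h2 : (Λ δ - Λ g) / β₀ * β₀ = Λ δ - Λ g := div_mul_cancel₀ _ hβ₀.ne'
    nlinarith
  have hlt : invFunOn Λ (Ioc 0 e') (Λ g + s * β₀) < δ := (hanti.lt_iff_gt hδmem m₁).mp hval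
  rw [Real.dist_eq, sub_zero, abs_of_pos m₁.1]
  exact hlt.trans_le (min_le_left _ _)

/-! ## §72 The continuous renormalization group of the flow with memory near zero pin -/

/-- **THE CONTINUOUS RENORMALIZATION GROUP EXISTS NEAR ZERO PIN.**  `B` with memory profile `(C_m, θ)` on ]0, γ]^ℕ (0 ≤ θ < 1, C_m ≥ 0) and the value β₀ at the zero
history; ONE AF reference t (`MemFlow B g* t`, `1∕t_a² + β*·m ≤ 1∕t(m)²`); the reference pin e′ with part 14's package; a box solution h′ from e′.  THEN there is a
two-parameter family `φ : ℝ → ℝ → ℝ` — a ONE-PARAMETER SEMIGROUP ON ]0, e′] for `s ≥ 0`: `φ s g ∈ ]0, e′]`, `φ 0 g = g`, **`φ (s + s′) g = φ s (φ s′ g)`** — such that: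
(orbits) **`φ k e = h k` for EVERY box solution h from EVERY pin `e ∈ ]0, e′]` and every `k : ℕ`** — the integer times of the semigroup ARE the trajectories of the flow
with memory, `φ 1` IS the renormalization step and `φ (1∕2) (φ (1∕2) g) = φ 1 g` is HALF A STEP; (order) each `φ s` is strictly increasing, `s ↦ φ s g` strictly
decreasing; (rates) **`(3∕4)β₀(s′ − s) ≤ 1∕φ s′ g² − 1∕φ s g² ≤ (3∕2)β₀(s′ − s)`** for `0 ≤ s ≤ s′`; (UV) `φ s g → 0` and THE CONTINUOUS CLOCK **`s·β₀·(φ s g)² → 1`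
as `s → ∞`** — the discrete universal clock of part 33 interpolated to all real scales.  (φ is `s g ↦ Λ⁻¹(Λ g + sβ₀)` for part 35's Λ; by parts 44–45 and 47 it does
not depend on which principal Abel function is used.) [folklore; embedding via the Abel function: Szekeres 1958] -/
theorem continuousRG_exists {B : (ℕ → ℝ) → ℝ} {Cm θ γ β₀ bs ta gs e' : ℝ} {t h' : ℕ → ℝ}
    (hB : MemoryProfile Cm θ γ B) (hCm : 0 ≤ Cm) (hθ0 : 0 ≤ θ) (hθ1 : θ < 1) (hbs : 0 < bs) (hta : 0 < ta)
    (h0 : ∀ u : ℕ → ℝ, SeqBox γ u → |B u - β₀| ≤ Cm * ∑' j, θ ^ j * u j)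
    (hts : SeqBox γ t) (htf : MemFlow B gs t) (hprof : ∀ m : ℕ, 1 / ta ^ 2 + bs * (m : ℝ) ≤ 1 / (t m) ^ 2)
    (he' : 0 < e') (h2e' : 2 * e' ≤ γ)
    (hs1 : 4 * Cm * e' ≤ bs * (1 - θ))
    (hs2 : e' ^ 2 * (1 / gs ^ 2 + Cm * γ / (1 - θ) ^ 2 + (2 * Cm / ((1 - θ) * bs)) ^ 2) ≤ 3 / 4)
    (hs4 : 64 * Cm * e' ^ 3 ≤ (1 - θ) ^ 2) (hs5 : Cm * (8 * e' ^ 3 + 16 * e' / bs) ≤ (1 - θ) / 4)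
    (hhs' : SeqBox γ h') (hhf' : MemFlow B e' h') :
    ∃ φ : ℝ → ℝ → ℝ,
      (∀ s : ℝ, 0 ≤ s → ∀ g ∈ Ioc (0 : ℝ) e', φ s g ∈ Ioc (0 : ℝ) e') ∧
      (∀ g ∈ Ioc (0 : ℝ) e', φ 0 g = g) ∧
      (∀ s s' : ℝ, 0 ≤ s → 0 ≤ s' → ∀ g ∈ Ioc (0 : ℝ) e', φ (s + s') g = φ s (φ s' g)) ∧
      (∀ e ∈ Ioc (0 : ℝ) e', ∀ h : ℕ → ℝ, SeqBox γ h → MemFlow B e h → ∀ k : ℕ, φ k e = h k) ∧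
      (∀ g ∈ Ioc (0 : ℝ) e', φ (1 / 2) (φ (1 / 2) g) = φ 1 g) ∧
      (∀ s : ℝ, 0 ≤ s → StrictMonoOn (φ s) (Ioc 0 e')) ∧
      (∀ g ∈ Ioc (0 : ℝ) e', ∀ s s' : ℝ, 0 ≤ s → s < s' → φ s' g < φ s g) ∧
      (∀ g ∈ Ioc (0 : ℝ) e', ∀ s s' : ℝ, 0 ≤ s → s ≤ s' →
        3 / 4 * β₀ * (s' - s) ≤ 1 / φ s' g ^ 2 - 1 / φ s g ^ 2 ∧ 1 / φ s' g ^ 2 - 1 / φ s g ^ 2 ≤ 3 / 2 * β₀ * (s' - s)) ∧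
      (∀ g ∈ Ioc (0 : ℝ) e', Tendsto (fun s : ℝ => φ s g) atTop (𝓝 0)) ∧
      (∀ g ∈ Ioc (0 : ℝ) e', Tendsto (fun s : ℝ => s * β₀ * φ s g ^ 2) atTop (𝓝 1)) := by
  have hβ₀ : 0 < β₀ :=
    EriceFlowEnclosureB12AsPrintedHistoryContagionShiftFlowZero.valueAtZero_pos hCm hθ0 hθ1 hbs hta h0 hts htf hprof
  obtain ⟨Λ, hΛ0, hΛ, hbounds, hanti, -, habel, hsurj⟩ :=
    relativeLambda_exists hB hCm hθ0 hθ1 hbs hta h0 hts htf hprof he' h2e' hs1 hs2 hs4 hs5 hhs' hhf'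
  have honto : ∀ y : ℝ, Λ e' ≤ y → ∃ x ∈ Ioc (0 : ℝ) e', Λ x = y := by
    intro y hy
    rw [hΛ0] at hy
    obtain ⟨x, hx, -⟩ := hsurj y hy
    exact ⟨x, hx.1, hx.2⟩
  -- the comparison sequence of Λ is 1∕h′²: Λ is a dynamical Abel function in the sense of part 44
  have hdyn : ∀ e ∈ Ioc (0 : ℝ) e', ∀ h : ℕ → ℝ, SeqBox γ h → MemFlow B e h →
      Tendsto (fun n => 1 / h n ^ 2 - 1 / h' n ^ 2) atTop (𝓝 (Λ e)) := hΛ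
  set φ : ℝ → ℝ → ℝ := fun s g => invFunOn Λ (Ioc 0 e') (Λ g + s * β₀) with hφ
  have hmem : ∀ s : ℝ, 0 ≤ s → ∀ g ∈ Ioc (0 : ℝ) e', φ s g ∈ Ioc (0 : ℝ) e' ∧ Λ (φ s g) = Λ g + s * β₀ :=
    fun s hs g hg => rg_mem_eq hanti honto hβ₀.le hg hs
  refine ⟨φ, fun s hs g hg => (hmem s hs g hg).1, fun g hg => rg_zero hanti hg, fun s s' hs hs' g hg => rg_add hanti honto hβ₀.le hg hs hs',
    ?_, fun g hg => rg_half_half hanti honto hβ₀.le hg, fun s hs => rg_strictMonoOn hanti honto hβ₀.le hs,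
    fun g hg s s' hs hss' => rg_lt_rg_of_lt hanti honto hβ₀ hg hs hss', ?_, fun g hg => rg_tendsto_zero hanti honto hβ₀ hg, ?_⟩
  · -- orbits = trajectories
    intro e he h hhs hhf k
    have hmono := fun m => EriceFlowEnclosureB12AsPrintedHistoryContagionShiftFlowZeroOffset.succ_le_of_reference_flow hB hCm hθ0 hθ1 hbs hta h0 hts htf
      hprof hhs hhf (EriceFlowEnclosureB12AsPrintedHistoryContagionShiftFlowZeroOffset.package_of_le hCm hθ1 hbs (by linarith) he.1 he.2 hs1 hs2 hs4 hs5).1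
      (EriceFlowEnclosureB12AsPrintedHistoryContagionShiftFlowZeroOffset.package_of_le hCm hθ1 hbs (by linarith) he.1 he.2 hs1 hs2 hs4 hs5).2.1 m
    exact rg_natCast_eq hanti honto hβ₀.le he (fun m => ⟨(hhs m).1, (hmono m).2.2.trans he.2⟩) (habel e he h hhs hhf) k
  · -- chart rates per unit scale
    intro g hg s s' hs hss'
    obtain ⟨m₁, e₁⟩ := hmem s hs g hg
    obtain ⟨m₂, e₂⟩ := hmem s' (hs.trans hss') g hg
    have hle : φ s' g ≤ φ s g := by
      rcases eq_or_lt_of_le hss' with h | h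
      · rw [h]
      · exact (rg_lt_rg_of_lt hanti honto hβ₀ hg hs h).le
    have hb := hbounds (φ s' g) m₂ (φ s g) m₁ hle
    rw [e₁, e₂] at hb
    constructor <;> nlinarith [hb.1, hb.2]
  · -- the continuous clock
    intro g hg
    have hsc := tendsto_sq_mul_dynAbel hB hCm hθ0 hθ1 hbs hta h0 hts htf hprof hdyn he' h2e' hs1 hs2 hs4 hs5 hhs' hhf'
    have hto : Tendsto (fun s : ℝ => φ s g) atTop (𝓝[>] 0) := by
      refine tendsto_nhdsWithin_iff.mpr ⟨rg_tendsto_zero hanti honto hβ₀ hg, ?_⟩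
      filter_upwards [eventually_ge_atTop 0] with s hs
      exact (hmem s hs g hg).1.1
    have h1 : Tendsto (fun s : ℝ => φ s g ^ 2 * (Λ (φ s g) - Λ e')) atTop (𝓝 1) := hsc.comp hto
    -- `φ_s(g)²·(Λ g + sβ₀) → 1` and `φ_s(g)²·Λ g → 0`
    have h2 : Tendsto (fun s : ℝ => φ s g ^ 2 * (Λ g + s * β₀)) atTop (𝓝 1) := by
      refine h1.congr' ?_
      filter_upwards [eventually_ge_atTop 0] with s hs
      rw [(hmem s hs g hg).2, hΛ0, sub_zero]
    have h3 : Tendsto (fun s : ℝ => φ s g ^ 2 * Λ g) atTop (𝓝 0) := by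
      have := ((rg_tendsto_zero hanti honto hβ₀ hg).pow 2).mul_const (Λ g)
      simpa using this
    have h4 := h2.sub h3
    simp only [sub_zero] at h4
    exact h4.congr fun s => by ring

end

end Summit.QuantumFields.BalabanUV.Beta.EriceFlowEnclosureB12AsPrintedHistoryContagionShiftFlowZeroSemigroup
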